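import Mathlib
import Literature.Probability.Percolation.ConditionalPositiveAssociation
import Literature.Probability.Percolation.KozmaNitzanPinning
import Literature.Probability.Percolation.LongRangeKernelPercolationProofs
import Summits.CriticalPhenomena.PercolationContinuityZ3.Theorems.PercNearOneGluingNearOneGluingDepthOneGluing
import Summits.CriticalPhenomena.PercolationContinuityZ3.Theorems.PercNearOneGluingNearOneGluingKnLemma3i
import HarnessLib

/-!
# Crux `PercNearOneGluing.NoHeavyLowerTail` (stmt-CriticalPhenomena-4575), line `bhk-superadditivity-thinning` —
# tooling for the residual: depth-one gluing through ANY admissible relay point (KN Thm 4, unconditional)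

Lead `prover-line-stmt-CriticalPhenomena-4575-0`, 2026-08-16; lands with
`--supports stmt-CriticalPhenomena-4575` (tool for the residual `stub_manyFingersLargePocket`).

Kozma–Nitzan (arXiv:2401.12397) §3.2, Theorem 4 / Lemma 5: if every positive-weight non-loop pair at
`s` goes to the relay set `A` (`s ∉ A`), then for EVERY relay point `a` that is *admissible* — its
connection probability to `b` with the star of `s` closed is at most that of every positive-weight
star neighbour `v ∈ A` of `s` —
`P(s ↔ A, s ↮ b) ≤ P(s ↔ A, a ↮ b)`.
The sibling theorem `depthOneGluing` (crux stmt-4574) states only the consequence with the minimiser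
`a₀` and a common bound `t ≥ max_{a∈A} P(a ↮ b)`, and takes KN Lemma 3(i) as a hypothesis; here the
admissible point is a parameter (this is what the proof on p. 14 actually uses: `hmin` is invoked only
at star neighbours), and Lemma 3(i) is discharged by the landed `knLemma3i`, so the statement is
unconditional.  In the application to the residual, `s` is the observer's relay-free pocket contracted
to a point, and the freedom in `a` is exactly the "selection" the residual has to control
(`min` over admissible points instead of `max` over all relay points as in the sibling's `pocketBound`).
-/

namespace Summit.CriticalPhenomena.PercolationContinuityZ3.Theorems

open scoped BigOperators Classical
open MeasureTheory Set
open Literature.Probability.LatticeModels (prodBernoulli)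
open Literature.Probability.Percolation (openConn openConnIn openCluster pinW
  measurableSet_openConn_holds)
open DepthOneGluing Literature.Probability.LatticeModels Literature.Probability.Percolation

/-- **Depth-one gluing through an admissible relay point** (Kozma–Nitzan arXiv:2401.12397, Theorem 4
with Lemma 5, p. 12–14, unconditional): let `F` be the star of `s` (the non-loop pairs containing
`s`), suppose every positive-weight pair of `F` goes to `A` and `s ∉ A`, and let `a` be a vertex
whose connection probability to `b` with the star pinned CLOSED (`pinW w F ∅`, i.e. in `G ∖ s`) is
at most that of every positive-weight star neighbour `v ∈ A`.  Then
`P(s ↔ A, s ↮ b) ≤ P(s ↔ A, a ↮ b)`.  Proof: KN Lemma 5 for every open-star pattern `T ∋ s(s,v)`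
(Lemma 3(i) = `knLemma3i` under the auxiliary weights `ε` on `T`, `0` on `F ∖ T`, then `ε → 0`),
summed over the patterns (`real_openConn_inter_le`), and `P(U ∩ Xᶜ) = P(U) − P(U ∩ X)`.
[cite: KozmaNitzan2024, §3.2 Theorem 4 and Lemma 5 (pp. 12–14)] -/
theorem depthOneGluing_admissible (n : ℕ) (w : Sym2 (Fin n) → unitInterval) (A : Finset (Fin n))
    (s b a : Fin n) (hsA : s ∉ A)
    (hiso : ∀ x : Fin n, x ∉ A → x ≠ s → w s(s, x) = 0)
    (hadm : ∀ v ∈ A, w s(s, v) ≠ 0 →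
      (prodBernoulli (pinW w ↑(Finset.univ.filter fun e : Sym2 (Fin n) => s ∈ e ∧ ¬ e.IsDiag)
          (∅ : Set (Sym2 (Fin n))))).real (openConn a b) ≤
        (prodBernoulli (pinW w ↑(Finset.univ.filter fun e : Sym2 (Fin n) => s ∈ e ∧ ¬ e.IsDiag)
          (∅ : Set (Sym2 (Fin n))))).real (openConn v b)) :
    (prodBernoulli w).real ((⋃ a' ∈ A, openConn s a') ∩ (openConn s b)ᶜ) ≤
      (prodBernoulli w).real ((⋃ a' ∈ A, openConn s a') ∩ (openConn a b)ᶜ) := by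
  -- the star `F` of `s`
  set F : Finset (Sym2 (Fin n)) := Finset.univ.filter fun e => s ∈ e ∧ ¬ e.IsDiag with hFd
  have hF : ∀ e, e ∈ F ↔ s ∈ e ∧ ¬ e.IsDiag := fun e => by simp [hFd]
  -- KN Theorem 4 (Lemma 5 summed over the star patterns) for the admissible point `a`
  have key : (prodBernoulli w).real ((⋃ a' ∈ A, openConn s a') ∩ openConn a b) ≤
      (prodBernoulli w).real ((⋃ a' ∈ A, openConn s a') ∩ openConn s b) := by
    rw [real_iUnion_openConn_inter hF hsA hiso, real_iUnion_openConn_inter hF hsA hiso]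
    refine real_openConn_inter_le hF fun T hTF v hvT h0 => ?_
    have hvs : v ≠ s := (mk_mem_star hF).1 (hTF hvT)
    have hvA : v ∈ A := by_contra fun hvA => h0 _ hvT (hiso v hvA hvs)
    have hwv : w s(s, v) ≠ 0 := h0 _ hvT
    refine lemma5 hF hTF hvT (le_of_forall_unitInterval F.card fun ε hε => ?_)
    -- KN's auxiliary weights `H_ε`
    let w' : Sym2 (Fin n) → unitInterval := fun e => if e ∈ F then (if e ∈ T then ε else 0) else w e
    have hw' : ∀ e, w' e = if e ∈ F then (if e ∈ T then ε else 0) else w e := fun e => rfl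
    exact pin_le_pin_add hw' hTF hε (knLemma3i n w' a v b
      {ω : Set (Sym2 (Fin n)) | (↑T : Set (Sym2 (Fin n))) ⊆ ω} (F.card * ε)
      (allOpen_mono hF hTF hvT) (mul_nonneg (Nat.cast_nonneg _) ε.2.1)
      (real_openConn_auxW_le hw' b (hadm v hvA hwv)))
  have e1 := measureReal_inter_add_sdiff (μ := prodBernoulli w) (s := ⋃ a' ∈ A, openConn s a')
    (t := openConn s b) MeasurableSet.of_discrete (measure_ne_top _ _)
  have e2 := measureReal_inter_add_sdiff (μ := prodBernoulli w) (s := ⋃ a' ∈ A, openConn s a')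
    (t := openConn a b) MeasurableSet.of_discrete (measure_ne_top _ _)
  calc (prodBernoulli w).real ((⋃ a' ∈ A, openConn s a') ∩ (openConn s b)ᶜ)
        = (prodBernoulli w).real ((⋃ a' ∈ A, openConn s a') \ openConn s b) := by
          rw [Set.sdiff_eq]
    _ ≤ (prodBernoulli w).real ((⋃ a' ∈ A, openConn s a') \ openConn a b) := by linarith
    _ = (prodBernoulli w).real ((⋃ a' ∈ A, openConn s a') ∩ (openConn a b)ᶜ) := by
          rw [Set.sdiff_eq]

/-- **Corollary (the additive form through an admissible point).** Under the hypotheses of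
`depthOneGluing_admissible`, `P(s ↔ A, s ↮ b) ≤ P(a ↮ b)`: the observer's gluing defect is paid by the
disconnection of ONE admissible relay point (Kozma–Nitzan Theorem 4 concludes with the minimiser
`a₀` and `max_a P(a ↮ b)`). [cite: KozmaNitzan2024, §3.2 Theorem 4 (p. 12)] -/
theorem depthOneGluing_admissible_le (n : ℕ) (w : Sym2 (Fin n) → unitInterval) (A : Finset (Fin n))
    (s b a : Fin n) (hsA : s ∉ A)
    (hiso : ∀ x : Fin n, x ∉ A → x ≠ s → w s(s, x) = 0)
    (hadm : ∀ v ∈ A, w s(s, v) ≠ 0 →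
      (prodBernoulli (pinW w ↑(Finset.univ.filter fun e : Sym2 (Fin n) => s ∈ e ∧ ¬ e.IsDiag)
          (∅ : Set (Sym2 (Fin n))))).real (openConn a b) ≤
        (prodBernoulli (pinW w ↑(Finset.univ.filter fun e : Sym2 (Fin n) => s ∈ e ∧ ¬ e.IsDiag)
          (∅ : Set (Sym2 (Fin n))))).real (openConn v b)) :
    (prodBernoulli w).real ((⋃ a' ∈ A, openConn s a') ∩ (openConn s b)ᶜ) ≤
      (prodBernoulli w).real (openConn a b)ᶜ :=
  (depthOneGluing_admissible n w A s b a hsA hiso hadm).trans (measureReal_mono Set.inter_subset_right)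

/-- **Registered sub-goal `depthOneGluing_adm` of crux stmt-CriticalPhenomena-4575** (verbatim signature, fully
qualified): depth-one gluing through an admissible relay point, `P(s ↔ A, s ↮ b) ≤ P(s ↔ A, a ↮ b)` —
see `depthOneGluing_admissible`. [cite: KozmaNitzan2024, §3.2 Theorem 4 and Lemma 5 (pp. 12–14)] -/
theorem depthOneGluing_adm :
    ∀ (n : ℕ) (w : Sym2 (Fin n) → unitInterval) (A : Finset (Fin n)) (s b a : Fin n), s ∉ A → (∀ x :
      Fin n, x ∉ A → x ≠ s → w s(s, x) = 0) → (∀ v ∈ A, w s(s, v) ≠ 0 →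
      (Literature.Probability.LatticeModels.prodBernoulli (Literature.Probability.Percolation.pinW w
      ↑(Finset.univ.filter fun e : Sym2 (Fin n) => s ∈ e ∧ ¬ e.IsDiag) (∅ : Set (Sym2 (Fin n))))).real
      (Literature.Probability.Percolation.openConn a b) ≤
      (Literature.Probability.LatticeModels.prodBernoulli (Literature.Probability.Percolation.pinW w
      ↑(Finset.univ.filter fun e : Sym2 (Fin n) => s ∈ e ∧ ¬ e.IsDiag) (∅ : Set (Sym2 (Fin n))))).real
      (Literature.Probability.Percolation.openConn v b)) →
      (Literature.Probability.LatticeModels.prodBernoulli w).real ((⋃ a' ∈ A,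
      Literature.Probability.Percolation.openConn s a') ∩ (Literature.Probability.Percolation.openConn
      s b)ᶜ) ≤ (Literature.Probability.LatticeModels.prodBernoulli w).real ((⋃ a' ∈ A,
      Literature.Probability.Percolation.openConn s a') ∩ (Literature.Probability.Percolation.openConn
      a b)ᶜ) :=
  fun n w A s b a hsA hiso hadm => depthOneGluing_admissible n w A s b a hsA hiso hadm

end Summit.CriticalPhenomena.PercolationContinuityZ3.Theorems
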